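import Mathlib
import HarnessLib
import Summits.NavierStokesRegularity.NavierStokesRegularity.Theses.LocalIrrotationalScarDoor
import Summits.NavierStokesRegularity.NavierStokesRegularity.Theorems.LocalIrrotationalScarDoorTargetTheorem

/-!
# Route `LocalIrrotationalScarDoor` (door S15, nsreg-p1 ROUND-14) — birth closer for the item `Target`

Filed by nsreg-p6 (the door is MOOT-BY-PROOF: K1Rep p493989, K2Rep p489778, Target p494432 are tree theorems).
WHAT THIS IS NOT: not NS regularity — a by-name link from the route item to a tree theorem.
-/

noncomputable section

-- the summit and its single sub-problem share the name (CONVENTIONS §1), as in every Theorems file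
set_option linter.dupNamespace false

namespace Summit.NavierStokesRegularity.NavierStokesRegularity.Theorems.LocalIrrotationalScarDoorTargetClose

/-- **Target holds** (birth closer; CAPSTONE for `route close --proved`): the route's `Target` is the tree theorem
`…Theorems.LocalIrrotationalScarDoorTargetTheorem.localIrrotationalScarDoor_target` (nsreg-p6 g7, p494432), verbatim. -/
theorem target_proof : Summit.NavierStokesRegularity.NavierStokesRegularity.Theses.LocalIrrotationalScarDoor.Target :=
  Summit.NavierStokesRegularity.NavierStokesRegularity.Theorems.LocalIrrotationalScarDoorTargetTheorem.localIrrotationalScarDoor_target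

end Summit.NavierStokesRegularity.NavierStokesRegularity.Theorems.LocalIrrotationalScarDoorTargetClose

end
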